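import Summits.NavierStokesRegularity.NavierStokesRegularity.Theorems.ExtremiserTransienceNearExtremalTransienceExtremiserLiouvilleConstantSpeedAngularMoment
import HarnessLib

/-!
# Crux `ExtremiserTransience.NearExtremalTransience` (stmt-NavierStokesRegularity-21883), line `extremiser_liouville`,
# stub K1b — LINEAR-MOMENT (VIRIAL) IDENTITIES OF THE EULER–LAGRANGE DENSITY: `lim ∫χ_R⟪G, Ax⟫dx = ⟪curl A, ∫v dμ⟫`

`--supports stmt-NavierStokesRegularity-21883` (helper).  Author: prover seat `ns-el-k1b` (g3).

Generalisation of `…ConstantSpeedAngularMoment` from rotations `e × x` to ALL linear fields `x ↦ Ax`: testing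
`G dx = curl(vμ)` with `χ_R · Ax` (`curl(χ·A·) = χ·curlCLM A + curlCLM(Dχ ⊗ Ax)`, the second term supported on the annulus
with `‖Dχ_R‖‖x‖ ≤ 2C`) and dominated convergence in the finite measure `μ`:

* `tendsto_integral_density_cutoff_clm` : **`∫ χ_R ⟪G, A x⟫ dx ⟶ ⟪curlCLM A, b⟫ = ∫⟪v, curlCLM A⟫dμ`**, `b = ∫ v dμ` the
  barycentre of the multiplier (`curlCLM A` is the constant curl of the linear field `Ax`, the axial vector of `A − Aᵀ`);
* `tendsto_integral_density_cutoff_clm_of_curl_eq_zero` : **if `curlCLM A = 0` (e.g. `A` symmetric; `curlCLM_id`) then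
  `∫ χ_R ⟪G, A x⟫ dx ⟶ 0`** — SIX multiplier-free scalar identities (principal-value symmetric first moments of the E–L density
  vanish), in addition to the sign condition of `…AngularMoment` on the `c`-torque;
* `residue_symmetricMoments_eq_zero` : the package for the K1b residue object with the explicit `G` (all inputs discharged),
  including `A = id`: `∫χ_R ⟪G, x⟫ dx → 0`.

WHAT THIS IS NOT: necessary conditions on the HYPOTHETICAL K1b residue object; K1b is NOT proved; nothing here proves NS
regularity. [folklore]
-/

noncomputable section

open Set Filter Topology MeasureTheory Metric Function
open scoped ENNReal NNReal Topology InnerProductSpace RealInnerProductSpace ContDiff Laplacian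
open Literature.Analysis.FluidPDE Literature.Analysis

namespace Summit.NavierStokesRegularity.NavierStokesRegularity.Theorems

-- the problem directory repeats the summit name (`NavierStokesRegularity/NavierStokesRegularity`)
set_option linter.dupNamespace false

namespace ExtremiserLiouville

open DepletionLadder.KStar DepletionLadder.KStar.HalfSpace

variable {v G : E3 → E3} {M : ℝ} {μ : Measure E3}

/-- `curl (χ · A·)(x) = χ(x)·curlCLM A + curlCLM (Dχ(x) ⊗ Ax)` for a differentiable scalar `χ` and a linear `A`. [folklore] -/
theorem curl_smul_clm (A : E3 →L[ℝ] E3) {χ : E3 → ℝ} {x : E3} (hχ : DifferentiableAt ℝ χ x) :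
    curl (fun y => χ y • A y) x = χ x • curlCLM A + curlCLM ((fderiv ℝ χ x).smulRight (A x)) := by
  rw [curl_smul hχ A.differentiableAt, curl_eq_curlCLM, A.fderiv]

/-- The identity map has zero curl. [folklore] -/
theorem curlCLM_id : curlCLM (ContinuousLinearMap.id ℝ E3) = 0 := by
  ext i
  fin_cases i <;> simp [curlCLM, curlLM]

/-- **Linear-moment identity: `∫ χ_R ⟪G, A x⟫ dx → ∫⟪v, curlCLM A⟫dμ`** (`R → ∞`) whenever `G dx = curl(vμ)` on test
fields, `μ` finite and `‖v‖ ≤ M`. [folklore] -/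
theorem tendsto_integral_density_cutoff_clm (hv : ContDiff ℝ ∞ v) {M : ℝ} (hM : ∀ x, ‖v x‖ ≤ M)
    (hG : ∀ η : E3 → E3, ContDiff ℝ ∞ η → HasCompactSupport η →
      Jst v * J1 v (curl η) - kStar ^ 2 * M ^ 2 * (Wpa v * A1 v (curl η) + Zen v * C1 v (curl η)) = ∫ x, ⟪G x, η x⟫_ℝ)
    [IsFiniteMeasure μ]
    (hμ : ∀ φ : E3 → E3, ContDiff ℝ ∞ φ → HasCompactSupport φ → VectorCalculus.IsDivFree φ →
      Jst v * J1 v φ - kStar ^ 2 * M ^ 2 * (Wpa v * A1 v φ + Zen v * C1 v φ) = ∫ x, ⟪v x, φ x⟫_ℝ ∂μ)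
    (A : E3 →L[ℝ] E3) :
    Tendsto (fun R : ℝ => ∫ x, ⟪G x, cutoff R x • A x⟫_ℝ) atTop (𝓝 (∫ x, ⟪v x, curlCLM A⟫_ℝ ∂μ)) := by
  obtain ⟨C, hC0, hC⟩ := exists_norm_fderiv_cutoff_le (E := E3)
  have hM0 : 0 ≤ M := (norm_nonneg _).trans (hM 0)
  have hη : ∀ R, ContDiff ℝ ∞ fun y => cutoff R y • A y := fun R => (contDiff_cutoff R).smul A.contDiff
  have hηc : ∀ R, 0 < R → HasCompactSupport fun y => cutoff R y • A y := fun R hR =>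
    (hasCompactSupport_cutoff hR).smul_right
  have hid : ∀ R, 0 < R → ∫ x, ⟪G x, cutoff R x • A x⟫_ℝ =
      ∫ x, ⟪v x, curl (fun y => cutoff R y • A y) x⟫_ℝ ∂μ := fun R hR =>
    multiplier_curl_identity hG hμ (hη R) (hηc R hR)
  have hcurl : ∀ R x, ⟪v x, curl (fun y => cutoff R y • A y) x⟫_ℝ =
      cutoff R x * ⟪v x, curlCLM A⟫_ℝ + ⟪v x, curlCLM ((fderiv ℝ (cutoff R) x).smulRight (A x))⟫_ℝ := by
    intro R x
    rw [curl_smul_clm A (((contDiff_cutoff (n := 1) R).differentiable one_ne_zero) x), inner_add_right,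
      real_inner_smul_right]
  set κ : ℝ := ‖curlCLM‖ with hκ
  have hlim : Tendsto (fun R : ℝ => ∫ x, ⟪v x, curl (fun y => cutoff R y • A y) x⟫_ℝ ∂μ) atTop
      (𝓝 (∫ x, ⟪v x, curlCLM A⟫_ℝ ∂μ)) := by
    refine tendsto_integral_filter_of_dominated_convergence (fun _ => M * ‖curlCLM A‖ + M * (κ * (2 * C * ‖A‖)))
      ?_ ?_ (integrable_const _) ?_
    · exact Eventually.of_forall fun R =>
        (hv.continuous.inner (contDiff_curl_top (hη R)).continuous).aestronglyMeasurable
    · refine (eventually_gt_atTop 0).mono fun R hR => Eventually.of_forall fun x => ?_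
      rw [hcurl R x, Real.norm_eq_abs]
      have hD : ‖fderiv ℝ (cutoff R) x‖ * ‖x‖ ≤ 2 * C := by
        by_cases hAnn : R ≤ ‖x‖ ∧ ‖x‖ ≤ 2 * R
        · calc ‖fderiv ℝ (cutoff R) x‖ * ‖x‖ ≤ (C / R) * (2 * R) := by gcongr; exacts [hC R hR x, hAnn.2]
            _ = 2 * C := by field_simp
        · rw [(fderiv_cutoff_eq_zero_of_not_mem hR hAnn).1, norm_zero, zero_mul]; positivity
      have h1 : |cutoff R x * ⟪v x, curlCLM A⟫_ℝ| ≤ M * ‖curlCLM A‖ := by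
        rw [abs_mul]
        calc |cutoff R x| * |⟪v x, curlCLM A⟫_ℝ| ≤ 1 * (‖v x‖ * ‖curlCLM A‖) :=
              mul_le_mul (abs_cutoff_le_one R x) (abs_real_inner_le_norm _ _) (abs_nonneg _) zero_le_one
          _ ≤ 1 * (M * ‖curlCLM A‖) := by gcongr; exact hM x
          _ = M * ‖curlCLM A‖ := one_mul _
      have h2 : |⟪v x, curlCLM ((fderiv ℝ (cutoff R) x).smulRight (A x))⟫_ℝ| ≤ M * (κ * (2 * C * ‖A‖)) := by
        calc |⟪v x, curlCLM ((fderiv ℝ (cutoff R) x).smulRight (A x))⟫_ℝ|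
            ≤ ‖v x‖ * ‖curlCLM ((fderiv ℝ (cutoff R) x).smulRight (A x))‖ := abs_real_inner_le_norm _ _
          _ ≤ M * (κ * (2 * C * ‖A‖)) := by
              refine mul_le_mul (hM x) ?_ (norm_nonneg _) hM0
              calc ‖curlCLM ((fderiv ℝ (cutoff R) x).smulRight (A x))‖
                  ≤ ‖curlCLM‖ * ‖(fderiv ℝ (cutoff R) x).smulRight (A x)‖ := curlCLM.le_opNorm _
                _ = κ * (‖fderiv ℝ (cutoff R) x‖ * ‖A x‖) := by rw [ContinuousLinearMap.norm_smulRight_apply]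
                _ ≤ κ * (‖fderiv ℝ (cutoff R) x‖ * (‖A‖ * ‖x‖)) := by gcongr; exact A.le_opNorm x
                _ = κ * ((‖fderiv ℝ (cutoff R) x‖ * ‖x‖) * ‖A‖) := by ring
                _ ≤ κ * (2 * C * ‖A‖) := by gcongr
      exact (abs_add_le _ _).trans (add_le_add h1 h2)
    · refine Eventually.of_forall fun x => ?_
      have hev : ∀ᶠ R : ℝ in atTop, ⟪v x, curl (fun y => cutoff R y • A y) x⟫_ℝ = ⟪v x, curlCLM A⟫_ℝ := by
        filter_upwards [eventually_gt_atTop ‖x‖] with R hR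
        have hR0 : 0 < R := lt_of_le_of_lt (norm_nonneg x) hR
        rw [hcurl R x, cutoff_eq_one hR0 hR.le, (fderiv_cutoff_eq_zero_of_not_mem hR0 (fun h => (not_le.2 hR) h.1)).1]
        simp
      exact (tendsto_const_nhds (x := ⟪v x, curlCLM A⟫_ℝ)).congr' (hev.mono fun R hR => hR.symm)
  exact hlim.congr' ((eventually_gt_atTop 0).mono fun R hR => (hid R hR).symm)

/-- **Vanishing symmetric moments: if `curlCLM A = 0` then `∫ χ_R ⟪G, A x⟫ dx → 0`.** [folklore] -/
theorem tendsto_integral_density_cutoff_clm_of_curl_eq_zero (hv : ContDiff ℝ ∞ v) {M : ℝ} (hM : ∀ x, ‖v x‖ ≤ M)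
    (hG : ∀ η : E3 → E3, ContDiff ℝ ∞ η → HasCompactSupport η →
      Jst v * J1 v (curl η) - kStar ^ 2 * M ^ 2 * (Wpa v * A1 v (curl η) + Zen v * C1 v (curl η)) = ∫ x, ⟪G x, η x⟫_ℝ)
    [IsFiniteMeasure μ]
    (hμ : ∀ φ : E3 → E3, ContDiff ℝ ∞ φ → HasCompactSupport φ → VectorCalculus.IsDivFree φ →
      Jst v * J1 v φ - kStar ^ 2 * M ^ 2 * (Wpa v * A1 v φ + Zen v * C1 v φ) = ∫ x, ⟪v x, φ x⟫_ℝ ∂μ)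
    {A : E3 →L[ℝ] E3} (hA : curlCLM A = 0) :
    Tendsto (fun R : ℝ => ∫ x, ⟪G x, cutoff R x • A x⟫_ℝ) atTop (𝓝 0) := by
  have h := tendsto_integral_density_cutoff_clm hv hM hG hμ A
  rw [hA] at h
  simpa using h

/-- **SYMMETRIC-MOMENT PACKAGE of the K1b residue object**: with `G` the explicit Euler–Lagrange density of a constant-speed
extended extremiser, `∫ χ_R ⟪G, A x⟫ dx → 0` for every linear `A` with `curlCLM A = 0`, in particular for `A = id`.
[folklore] -/
theorem residue_symmetricMoments_eq_zero (hv : ContDiff ℝ ∞ v) (hdiv : VectorCalculus.IsDivFree v) {M B : ℝ}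
    (hMpos : 0 < M) (hM : ∀ x, ‖v x‖ = M) (hB : ∀ x, ‖fderiv ℝ v x‖ ≤ B)
    (h1 : ∫⁻ x, ‖iteratedFDeriv ℝ 1 v x‖ₑ ^ 2 < ⊤) (h2 : ∫⁻ x, ‖iteratedFDeriv ℝ 2 v x‖ₑ ^ 2 < ⊤)
    (hatt : |Jst v| = kStar * M * Real.sqrt (Zen v) * Real.sqrt (Wpa v))
    (A : E3 →L[ℝ] E3) (hA : curlCLM A = 0 ∨ A = ContinuousLinearMap.id ℝ E3) :
    Tendsto (fun R : ℝ => ∫ x, ⟪(Jst v • (curl (curl (fun y => fderiv ℝ v y (curl v y))) x -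
          curl (fun y => fderiv ℝ (curl v) y (curl v y)) x +
          curl (curl (fun y => ∑ j, ⟪curl v y, fderiv ℝ v y (EuclideanSpace.basisFun (Fin 3) ℝ j)⟫_ℝ •
          EuclideanSpace.basisFun (Fin 3) ℝ j)) x) +
        (-(kStar ^ 2 * M ^ 2 * Wpa v)) • curl (curl (curl v)) x -
        (-(kStar ^ 2 * M ^ 2 * Zen v)) • curl (curl (Δ (curl v))) x), cutoff R x • A x⟫_ℝ) atTop (𝓝 0) := by
  have hA' : curlCLM A = 0 := by
    rcases hA with h | h
    · exact h
    · rw [h]; exact curlCLM_id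
  obtain ⟨μ, hfin, -, hμ⟩ := exists_multiplierMeasure hv hdiv hMpos hM hB h1 h2 hatt
  have hG : ∀ η : E3 → E3, ContDiff ℝ ∞ η → HasCompactSupport η →
      Jst v * J1 v (curl η) - kStar ^ 2 * M ^ 2 * (Wpa v * A1 v (curl η) + Zen v * C1 v (curl η)) =
        ∫ x, ⟪(Jst v • (curl (curl (fun y => fderiv ℝ v y (curl v y))) x -
          curl (fun y => fderiv ℝ (curl v) y (curl v y)) x +
          curl (curl (fun y => ∑ j, ⟪curl v y, fderiv ℝ v y (EuclideanSpace.basisFun (Fin 3) ℝ j)⟫_ℝ •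
          EuclideanSpace.basisFun (Fin 3) ℝ j)) x) +
        (-(kStar ^ 2 * M ^ 2 * Wpa v)) • curl (curl (curl v)) x -
        (-(kStar ^ 2 * M ^ 2 * Zen v)) • curl (curl (Δ (curl v))) x), η x⟫_ℝ := by
    intro η hη hηc
    rw [← density_formula hv (Jst v) (-(kStar ^ 2 * M ^ 2 * Wpa v)) (-(kStar ^ 2 * M ^ 2 * Zen v)) hη hηc]
    show Jst v * J1 v (curl η) - kStar ^ 2 * M ^ 2 * (Wpa v * A1 v (curl η) + Zen v * C1 v (curl η)) =
      Jst v * J1 v (curl η) + -(kStar ^ 2 * M ^ 2 * Wpa v) * A1 v (curl η) + -(kStar ^ 2 * M ^ 2 * Zen v) * C1 v (curl η)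
    ring
  exact tendsto_integral_density_cutoff_clm_of_curl_eq_zero hv (fun x => (hM x).le) hG hμ hA'

end ExtremiserLiouville

end Summit.NavierStokesRegularity.NavierStokesRegularity.Theorems

end
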